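import Literature.NumberTheory.GaloisRepresentations.AdicCompletionUnitRoots
import Literature.NumberTheory.GaloisRepresentations.LocalGlobalSubfields
import Mathlib.FieldTheory.Galois.Infinite
import HarnessLib

/-!
# Rigidity of the decomposition field and commensurable terminality of decomposition groups

Topic `NumberTheory/GaloisRepresentations`; theorems only (no definition, no named fact), in the
setting of `DecompositionGroupOfCompletion`: `K` a number field, `v` a finite place,
`K_v = v.adicCompletion K`, `ι = absClosureEmbedding K K_v : K̄ → \bar K_v`,
`res = absGaloisRestrict K K_v : Γ_{K_v} → Γ_K`, `𝔓₀ = adicCompletionPrime K v` the prime of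
`\bar ℤ_K` cut out by `ι`, `D_{𝔓₀} = res (Γ_{K_v})` (`decompositionSubgroup_adicCompletionPrime_eq_range`),
`|·| = spectralNorm K_v \bar K_v`.  The *decomposition field* of `𝔓₀` is
`Z₀ = K̄ ^ {D_{𝔓₀}} = ι⁻¹(K_v)`, the field of algebraic numbers of `K_v`.

* `absGaloisRestrict_smul_eq_of_mem_range`, `mem_range_of_forall_absGaloisRestrict_smul_eq` —
  `Z₀ = ι⁻¹(K_v)` is the fixed field of `res (Γ_{K_v})`;
* `exists_eq_absClosureEmbedding_of_pow_eq` — `Z₀` is relatively algebraically closed in `K_v`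
  (roots in `K_v` of `X^m - u`, `u ∈ Z₀`, lie in `Z₀`), whence `Z₀` is **henselian**;
* **`spectralNorm_absClosureEmbedding_smul_eq`** (RIGIDITY) — if `σ ∈ Γ_K` maps `Z₀` into
  `ι⁻¹(k')` for a FINITE extension `k' ⊆ \bar K_v` of `K_v`, then `|ι (σ x)| = |ι x|` for all
  `x ∈ Z₀`: `ι ∘ σ` is an isometry of the decomposition field.  (Units of `Z₀` have a power which
  is a principal unit, principal units are `ℓ^n`-th powers in `K_v` for all `n` by Hensel, their
  roots are algebraic hence in `Z₀`, so `ι σ` of a unit is `ℓ`-divisible in `k'`, hence of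
  absolute value `1` by discreteness of the valuation of `k'`; a uniformiser comes from `K` and is
  fixed by `σ`.)
* **`smul_adicCompletionPrime_eq_of_relIndex_ne_zero`** — if `D_{σ 𝔓₀} ∩ D_{𝔓₀}` has finite index
  in `D_{𝔓₀}`, then `σ 𝔓₀ = 𝔓₀`: distinct primes of `K̄` have non-commensurable decomposition
  groups (the number-field case of [NSW] Cor. 12.1.3 / F. K. Schmidt's theorem, proved here
  without Henselian valuation theory: the finite-index subgroup gives the finite extension `k'`,
  rigidity makes `𝔓₀` and `σ 𝔓₀` agree on the decomposition field of `σ 𝔓₀`, above which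
  `σ 𝔓₀` is the only prime — transitivity of `D_{σ𝔓₀}` on the primes above, Mathlib
  `Algebra.IsInvariant.exists_smul_of_under_eq_of_profinite`);
* **`commensurator_decompositionSubgroup_adicCompletionPrime`**,
  `commensurator_decompositionSubgroup_eq_of_mem_primesAbove` — **decomposition groups of
  nonarchimedean primes of `K̄` are commensurably terminal in `Γ_K`**: `C_{Γ_K}(D_𝔓) = D_𝔓`
  (Mochizuki, *The absolute anabelian geometry of hyperbolic curves* (2004), Thm. 1.1.1 (i),
  "a formal consequence of [NSW], Corollary 12.1.3").

## References

* J. Neukirch, A. Schmidt, K. Wingberg, *Cohomology of Number Fields*, Grundlehren 323 (2nd ed.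
  2008), Cor. 12.1.3. [NSW2008]
* S. Mochizuki, *The absolute anabelian geometry of hyperbolic curves*, Galois theory and modular
  forms, Kluwer (2004), Thm. 1.1.1 (i). [MochizukiAbsAnab2004]
* J. Neukirch, *Algebraic Number Theory*, Grundlehren 322 (1999), Ch. II §9 (9.6) (decomposition
  group and completion), §6 (henselian fields). [NeukirchANT1999]
-/

noncomputable section

open scoped NumberField Pointwise Valued
open Field IsDedekindDomain Polynomial

universe u

namespace Literature.NumberTheory.GaloisRepresentations

variable (K : Type u) [Field K] [NumberField K] (v : HeightOneSpectrum (𝓞 K))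

/-! ### The decomposition field `Z₀ = ι⁻¹(K_v)` -/

/-- Elements of `Z₀ = ι⁻¹(K_v)` are fixed by `res (Γ_{K_v}) = D_{𝔓₀}`: if `ι x ∈ K_v` then
`res τ • x = x` for every `τ ∈ Γ_{K_v}`. Neukirch, *Algebraic Number Theory*, Ch. II §9 (9.6).
[cite: NeukirchANT1999, Ch. II §9 Prop. (9.6)] -/
theorem absGaloisRestrict_smul_eq_of_mem_range (τ : absoluteGaloisGroup (v.adicCompletion K))
    {x : AlgebraicClosure K}
    (hx : absClosureEmbedding K (v.adicCompletion K) x ∈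
      Set.range (algebraMap (v.adicCompletion K) (AlgebraicClosure (v.adicCompletion K)))) :
    absGaloisRestrict K (v.adicCompletion K) τ • x = x := by
  apply (absClosureEmbedding K (v.adicCompletion K)).injective
  change absClosureEmbedding K (v.adicCompletion K) (absGaloisRestrict K (v.adicCompletion K) τ • x) =
    absClosureEmbedding K (v.adicCompletion K) x
  obtain ⟨y, hy⟩ := hx
  rw [absGaloisRestrict_apply_smul, ← hy, absoluteGaloisGroup.smul_def]
  exact AlgEquiv.commutes _ y

/-- Conversely, an element of `K̄` fixed by `res (Γ_{K_v})` lies in `Z₀ = ι⁻¹(K_v)` (the fixed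
field of `Γ_{K_v}` in `\bar K_v` is `K_v`, infinite Galois theory).  Hence `Z₀` is the
decomposition field `K̄^{D_{𝔓₀}}`. Neukirch, *Algebraic Number Theory*, Ch. II §9 (9.6).
[cite: NeukirchANT1999, Ch. II §9 Prop. (9.6)] -/
theorem mem_range_of_forall_absGaloisRestrict_smul_eq {x : AlgebraicClosure K}
    (h : ∀ τ : absoluteGaloisGroup (v.adicCompletion K),
      absGaloisRestrict K (v.adicCompletion K) τ • x = x) :
    absClosureEmbedding K (v.adicCompletion K) x ∈
      Set.range (algebraMap (v.adicCompletion K) (AlgebraicClosure (v.adicCompletion K))) := by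
  haveI : CharZero (v.adicCompletion K) :=
    charZero_of_injective_algebraMap (algebraMap K (v.adicCompletion K)).injective
  haveI : IsGalois (v.adicCompletion K) (AlgebraicClosure (v.adicCompletion K)) := {}
  rw [InfiniteGalois.mem_range_algebraMap_iff_fixed]
  intro f
  have h2 := congrArg (absClosureEmbedding K (v.adicCompletion K))
    (h ((absoluteGaloisGroup.toAlgEquiv (v.adicCompletion K)).symm f))
  rwa [absGaloisRestrict_apply_smul, absoluteGaloisGroup.toAlgEquiv_symm_apply] at h2

/-- **`Z₀` is relatively algebraically closed in `K_v`** (roots): if `r ∈ K_v` satisfies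
`r ^ m = ι u` for some `u ∈ K̄`, then `r = ι z` with `z ∈ K̄`, `z ^ m = u` (and `z ∈ Z₀`): `r`
is algebraic over `K`, and every `K`-algebraic element of `\bar K_v` lies in `ι(K̄)`
(`mem_range_of_aeval_eq_zero`).  This is the henselian property of the decomposition field.
Neukirch, *Algebraic Number Theory*, Ch. II §6 and §9. [cite: NeukirchANT1999, Ch. II §9 Prop. (9.6)] -/
theorem exists_eq_absClosureEmbedding_of_pow_eq {r : v.adicCompletion K} {u : AlgebraicClosure K}
    {m : ℕ} (hm : 0 < m)
    (h : algebraMap (v.adicCompletion K) (AlgebraicClosure (v.adicCompletion K)) r ^ m =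
      absClosureEmbedding K (v.adicCompletion K) u) :
    ∃ z : AlgebraicClosure K, absClosureEmbedding K (v.adicCompletion K) z =
        algebraMap (v.adicCompletion K) (AlgebraicClosure (v.adicCompletion K)) r ∧ z ^ m = u := by
  have hint : IsIntegral K u := Algebra.IsIntegral.isIntegral u
  have hg0 : (minpoly K u).comp (X ^ m) ≠ 0 := by
    rw [Ne, comp_eq_zero_iff, not_or]
    refine ⟨minpoly.ne_zero hint, ?_⟩
    rintro ⟨_, hX⟩
    have := congrArg natDegree hX
    rw [natDegree_X_pow, natDegree_C] at this
    exact hm.ne' this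
  have haeval : aeval (algebraMap (v.adicCompletion K) (AlgebraicClosure (v.adicCompletion K)) r)
      ((minpoly K u).comp (X ^ m)) = 0 := by
    rw [aeval_comp, aeval_X_pow, h, aeval_algHom_apply, minpoly.aeval, map_zero]
  obtain ⟨z, hz⟩ := mem_range_of_aeval_eq_zero (absClosureEmbedding K (v.adicCompletion K)) hg0 haeval
  refine ⟨z, hz, (absClosureEmbedding K (v.adicCompletion K)).injective ?_⟩
  change absClosureEmbedding K (v.adicCompletion K) (z ^ m) = absClosureEmbedding K (v.adicCompletion K) u
  rw [map_pow, hz, h]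

/-! ### Rigidity: `ι ∘ σ` is an isometry of the decomposition field -/

/-- **Rigidity of the decomposition field.**  Let `σ ∈ Γ_K` and let `k' ⊆ \bar K_v` be a FINITE
extension of `K_v` such that `ι (σ x) ∈ k'` whenever `ι x ∈ K_v` (i.e. `σ` maps the
decomposition field `Z₀ = ι⁻¹(K_v)` into `ι⁻¹(k')`).  Then `|ι (σ x)| = |ι x|` for every `x ∈ Z₀`.
Proof: write `x = ϖ^{-n} w` with `ϖ ∈ K` a uniformiser (fixed by `σ`) and `w ∈ Z₀` a unit; a power
`u = w^N` is a principal unit, hence (Hensel, and roots are algebraic) an `ℓ^j`-th power in `Z₀`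
for every `j`, `ℓ` a prime invertible at `v`; so `ι (σ u)` is `ℓ`-divisible in `k'`, whose
valuation is discrete: `|ι (σ u)| = 1`.  (The number-field case of the fact that a henselian
field admits no second henselian valuation, F. K. Schmidt; cf. [NSW] 12.1.3.)
[cite: NeukirchANT1999, Ch. II §6 and §9 Prop. (9.6)] -/
theorem spectralNorm_absClosureEmbedding_smul_eq (σ : absoluteGaloisGroup K)
    (k' : IntermediateField (v.adicCompletion K) (AlgebraicClosure (v.adicCompletion K)))
    [FiniteDimensional (v.adicCompletion K) k']
    (hσ : ∀ x : AlgebraicClosure K,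
      absClosureEmbedding K (v.adicCompletion K) x ∈
          Set.range (algebraMap (v.adicCompletion K) (AlgebraicClosure (v.adicCompletion K))) →
        absClosureEmbedding K (v.adicCompletion K) (σ • x) ∈ k')
    {x : AlgebraicClosure K}
    (hx : absClosureEmbedding K (v.adicCompletion K) x ∈
      Set.range (algebraMap (v.adicCompletion K) (AlgebraicClosure (v.adicCompletion K)))) :
    spectralNorm (v.adicCompletion K) (AlgebraicClosure (v.adicCompletion K))
        (absClosureEmbedding K (v.adicCompletion K) (σ • x)) =
      spectralNorm (v.adicCompletion K) (AlgebraicClosure (v.adicCompletion K))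
        (absClosureEmbedding K (v.adicCompletion K) x) := by
  letI : NormedField (AlgebraicClosure (v.adicCompletion K)) :=
    spectralNorm.normedField (v.adicCompletion K) (AlgebraicClosure (v.adicCompletion K))
  -- notation inside the proof: `ι`, and norms `‖z‖ = spectralNorm _ _ z` (definitionally)
  set ι := absClosureEmbedding K (v.adicCompletion K) with hι
  change ‖ι (σ • x)‖ = ‖ι x‖
  have hnorm_alg : ∀ y : v.adicCompletion K,
      ‖algebraMap (v.adicCompletion K) (AlgebraicClosure (v.adicCompletion K)) y‖ = ‖y‖ := fun y =>
    spectralNorm_extends y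
  -- `σ` fixes `K`
  have hσK : ∀ c : K, σ • algebraMap K (AlgebraicClosure K) c = algebraMap K (AlgebraicClosure K) c :=
    fun c => by rw [absoluteGaloisGroup.smul_def]; exact AlgEquiv.commutes _ c
  have hιK : ∀ c : K, ι (algebraMap K (AlgebraicClosure K) c) =
      algebraMap (v.adicCompletion K) (AlgebraicClosure (v.adicCompletion K))
        (algebraMap K (v.adicCompletion K) c) := fun c => by
    rw [hι, AlgHom.commutes,
      IsScalarTower.algebraMap_apply K (v.adicCompletion K) (AlgebraicClosure (v.adicCompletion K))]
  by_cases hx0 : x = 0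
  · rw [hx0, smul_zero]
  obtain ⟨y, hy⟩ := hx
  have hy0 : y ≠ 0 := by
    rintro rfl
    rw [map_zero] at hy
    exact hx0 (ι.injective (by rw [map_zero]; exact hy.symm))
  -- a uniformiser `ϖ ∈ K` and the exponent `n` of `x`
  have hq0 : (0 : ℝ) < ((Ideal.absNorm v.asIdeal : ℕ) : ℝ) :=
    lt_trans zero_lt_one (one_lt_absNorm_real K v)
  obtain ⟨ϖ, hϖ⟩ := exists_norm_algebraMap_eq_inv K v
  obtain ⟨n, hn⟩ := exists_norm_eq_zpow K v hy0
  have hϖ0 : algebraMap K (v.adicCompletion K) ϖ ≠ 0 := by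
    intro h0
    rw [h0, norm_zero] at hϖ
    exact (inv_pos.mpr hq0).ne hϖ
  set ϖbar : AlgebraicClosure K := algebraMap K (AlgebraicClosure K) ϖ with hϖbar
  have hιϖ : ι ϖbar = algebraMap (v.adicCompletion K) (AlgebraicClosure (v.adicCompletion K))
      (algebraMap K (v.adicCompletion K) ϖ) := hιK ϖ
  have hϖbar0 : ϖbar ≠ 0 := by
    intro h0
    apply hϖ0
    have := congrArg ι h0
    rw [map_zero, hιϖ] at this
    exact (algebraMap (v.adicCompletion K) (AlgebraicClosure (v.adicCompletion K))).injective
      (by rw [map_zero]; exact this)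
  have hσϖn : σ • ϖbar ^ n = ϖbar ^ n := by
    rw [absoluteGaloisGroup.smul_def, map_zpow₀, ← absoluteGaloisGroup.smul_def, hϖbar, hσK]
  -- the unit part `w = x * ϖ ^ n`
  set w : AlgebraicClosure K := x * ϖbar ^ n with hw
  set yw : v.adicCompletion K := y * algebraMap K (v.adicCompletion K) ϖ ^ n with hyw
  have hιw : ι w = algebraMap (v.adicCompletion K) (AlgebraicClosure (v.adicCompletion K)) yw := by
    rw [hw, map_mul, map_zpow₀, ← hy, hιϖ, hyw, map_mul, map_zpow₀]
  have hyw1 : ‖yw‖ = 1 := by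
    rw [hyw, norm_mul, norm_zpow, hn, hϖ, inv_zpow, mul_inv_cancel₀ (zpow_ne_zero n hq0.ne')]
  have hw0 : w ≠ 0 := mul_ne_zero hx0 (zpow_ne_zero n hϖbar0)
  -- units of `Z₀` go to units: `‖ι (σ • w)‖ = 1`
  have hunit : ‖ι (σ • w)‖ = 1 := by
    obtain ⟨N, hNpos, hN⟩ := exists_pos_forall_norm_pow_sub_one_lt K v
    obtain ⟨ℓ, hℓ, hℓu⟩ := exists_prime_isUnit_natCast K v
    have hpu : ‖yw ^ N - 1‖ < 1 := hN yw hyw1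
    set u : AlgebraicClosure K := w ^ N with hu
    have hu0 : u ≠ 0 := pow_ne_zero N hw0
    have hιu : ι u = algebraMap (v.adicCompletion K) (AlgebraicClosure (v.adicCompletion K))
        (yw ^ N) := by
      rw [hu, map_pow, hιw, map_pow]
    -- `u` is an `ℓ^j`-th power in `Z₀` for every `j`
    have hroots : ∀ j : ℕ, ∃ z : AlgebraicClosure K,
        ι z ∈ Set.range (algebraMap (v.adicCompletion K) (AlgebraicClosure (v.adicCompletion K))) ∧
          z ^ (ℓ ^ j) = u := by
      intro j
      have hunitj : IsUnit (((ℓ ^ j : ℕ) : ℕ) : v.adicCompletionIntegers K) := by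
        rw [Nat.cast_pow]
        exact hℓu.pow j
      obtain ⟨r, hr⟩ := exists_pow_eq_of_norm_sub_one_lt K v hpu hunitj
      have hr' : algebraMap (v.adicCompletion K) (AlgebraicClosure (v.adicCompletion K)) r ^ (ℓ ^ j) =
          ι u := by
        rw [← map_pow, hr, hιu]
      obtain ⟨z, hz, hzu⟩ := exists_eq_absClosureEmbedding_of_pow_eq K v (pow_pos hℓ.pos j) hr'
      exact ⟨z, ⟨r, hz.symm⟩, hzu⟩
    -- hence `ι (σ • u)` is `ℓ`-divisible in `k'`
    have hσu_mem : ι (σ • u) ∈ k' := hσ u ⟨yw ^ N, hιu.symm⟩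
    have hσu0 : ι (σ • u) ≠ 0 := by
      have h1 : σ • u ≠ 0 := (smul_ne_zero_iff_ne σ).mpr hu0
      exact fun h0 => h1 (ι.injective (h0.trans (map_zero ι).symm))
    have hdiv : ∀ j : ℕ, ∃ s ∈ k', s ^ (ℓ ^ j) = ι (σ • u) := by
      intro j
      obtain ⟨z, hz, hzu⟩ := hroots j
      refine ⟨ι (σ • z), hσ z hz, ?_⟩
      rw [← map_pow, ← smul_pow', hzu]
    have h1 : spectralNorm (v.adicCompletion K) (AlgebraicClosure (v.adicCompletion K)) (ι (σ • u)) = 1 :=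
      spectralNorm_eq_one_of_forall_exists_pow_eq K v k' hℓ hσu_mem hσu0 hdiv
    change ‖ι (σ • u)‖ = 1 at h1
    rw [hu, smul_pow', map_pow, norm_pow] at h1
    exact (pow_eq_one_iff_of_nonneg (norm_nonneg _) hNpos.ne').mp h1
  -- and `‖ι w‖ = 1`
  have hw1 : ‖ι w‖ = 1 := by rw [hιw, hnorm_alg, hyw1]
  -- `σ` fixes `ϖ`, so `ι (σ • w) = ι (σ • x) * ι ϖ ^ n`
  have hσw : ι (σ • w) = ι (σ • x) * ι ϖbar ^ n := by
    rw [hw, smul_mul', map_mul, hσϖn, map_zpow₀]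
  have hιϖ0 : ‖ι ϖbar‖ ≠ 0 :=
    norm_ne_zero_iff.mpr fun h0 => hϖbar0 (ι.injective (h0.trans (map_zero ι).symm))
  have e1 : ‖ι (σ • x)‖ * ‖ι ϖbar‖ ^ n = 1 := by
    rw [← norm_zpow, ← norm_mul, ← hσw, hunit]
  have e2 : ‖ι x‖ * ‖ι ϖbar‖ ^ n = 1 := by
    rw [← norm_zpow, ← norm_mul, ← map_zpow₀, ← map_mul, ← hw, hw1]
  exact mul_right_cancel₀ (zpow_ne_zero n hιϖ0) (e1.trans e2.symm)

end Literature.NumberTheory.GaloisRepresentations
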